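import Mathlib
import HarnessLib
import Summits.NavierStokesRegularity.NavierStokesRegularity.Theorems.UnthreadedDoorCellFluxDefs
import Summits.NavierStokesRegularity.NavierStokesRegularity.Theorems.UnthreadedDoorNetFluxNF1aDeltaContinuity

/-!
# Route `UnthreadedDoor`, crux `PoloidalLiouville` (stmt-NavierStokesRegularity-1222), WALL W1 — crux idea «cell-flux» (ns-idea-14 g6,
# `Cruxes/PoloidalLiouville/CellFluxSketch.lean` v1.2.3): stub Σ-0c `ClusterFluxZero`, PROVED (by name)

`CellFlux.clusterFluxZero : CellFlux.ClusterFluxZero` (the Theorems-side Defs twin p692073, body = sketch verbatim): if the cluster flux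
`r · Σ_{K ∈ 𝒦} osc_K f` of a cluster partition `𝒦` of `S_r(x₀) ∖ Γ` vanishes (`r > 0`, `f ∈ C¹` off `x₀`), then `∇f × (x − x₀) = 0` on the whole
sphere.  PROOF: the finitely many oscillations are `≥ 0` and sum to `0`, so `f` is constant on every class; a point `x` of the sphere is either
sphere-critical (done) or, by continuity of `∇f`, has a neighbourhood free of critical points, hence of sheet traces; every great-circle arc through
`x` short enough stays in that neighbourhood, is connected, so lies in the cell of `x`, which lies in the class of `x`: `f` is constant along it,
so `⟪∇f(x), n × (x − x₀)⟫ = 0` for every unit `n ⊥ x − x₀` (chain rule, `NF1a.hasDerivAt_greatCircle`), and the triple-product identity turns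
this into `∇f(x) × (x − x₀) = 0`.  In the sketch: `theorem stub_clusterFluxZero : ClusterFluxZero := Theorems.PoloidalLiouville.CellFlux.clusterFluxZero`.

HONEST LABEL: one S support stub of the cell-flux chain (critic V22 PASS-WITH-PRICE); K3^Σ, Z, Σ-5a, `PoloidalLiouville` (1222), W1 and the summit stay
OPEN; NO Navier–Stokes regularity statement is proved.  `--supports stmt-NavierStokesRegularity-1222 --as helper`.  [folklore]
-/

noncomputable section

-- the summit and its single sub-problem share the name (CONVENTIONS §1)
set_option linter.dupNamespace false

open Set Function Filter Topology InnerProductSpace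
open scoped RealInnerProductSpace

namespace Summit.NavierStokesRegularity.NavierStokesRegularity.Theorems.PoloidalLiouville.CellFlux

open Literature.Analysis Literature.Analysis.FluidPDE
open Summit.NavierStokesRegularity.NavierStokesRegularity.Theorems.PoloidalLiouville.NetFlux (E3)
open Summit.NavierStokesRegularity.NavierStokesRegularity.Theorems.PoloidalLiouville.NetFlux.NF1a
  (hasDerivAt_greatCircle norm_greatCircle_sub_center)

/-! ### Triple-product algebra -/

/-- `⟪g, w × a⟫ = ⟪w, a × g⟫` (cyclic scalar triple product). [folklore] -/
private theorem inner_cross_cyclic (g w a : E3) : ⟪g, cross w a⟫ = ⟪w, cross a g⟫ := by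
  simp only [cross, PiLp.inner_apply, RCLike.inner_apply, conj_trivial, Fin.sum_univ_three,
    cross_apply, Matrix.cons_val_zero, Matrix.cons_val_one, Matrix.cons_val_two,
    Matrix.head_cons, Matrix.tail_cons]
  ring

/-- `⟪a × g, a⟫ = 0`. [folklore] -/
private theorem inner_cross_self_left' (a g : E3) : ⟪cross a g, a⟫ = 0 := by
  simp only [cross, PiLp.inner_apply, RCLike.inner_apply, conj_trivial, Fin.sum_univ_three,
    cross_apply, Matrix.cons_val_zero, Matrix.cons_val_one, Matrix.cons_val_two,
    Matrix.head_cons, Matrix.tail_cons]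
  ring

/-- `g × a = −(a × g)`. [folklore] -/
private theorem cross_anticomm' (a g : E3) : cross g a = -cross a g := by
  ext i
  fin_cases i <;>
    simp [cross, cross_apply, Matrix.cons_val_zero, Matrix.cons_val_one, Matrix.cons_val_two, Matrix.head_cons,
      Matrix.tail_cons] <;> ring

/-- If `⟪g, n × a⟫ = 0` for every unit `n ⊥ a`, then `g × a = 0`. [folklore] -/
theorem cross_eq_zero_of_forall_inner_cross (g a : E3)
    (h : ∀ n : E3, ‖n‖ = 1 → ⟪n, a⟫ = 0 → ⟪g, cross n a⟫ = 0) : cross g a = 0 := by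
  set w : E3 := cross a g with hw
  by_cases hw0 : w = 0
  · rw [cross_anticomm', ← hw, hw0, neg_zero]
  · exfalso
    have hwn : 0 < ‖w‖ := norm_pos_iff.2 hw0
    set n : E3 := ‖w‖⁻¹ • w with hn
    have hn1 : ‖n‖ = 1 := by
      rw [hn, norm_smul, norm_inv, norm_norm, inv_mul_cancel₀ hwn.ne']
    have hna : ⟪n, a⟫ = 0 := by
      rw [hn, real_inner_smul_left, hw, inner_cross_self_left', mul_zero]
    have h1 := h n hn1 hna
    rw [hn] at h1
    have h2 : ⟪g, cross (‖w‖⁻¹ • w) a⟫ = ‖w‖⁻¹ * ⟪w, w⟫ := by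
      have e : cross (‖w‖⁻¹ • w) a = ‖w‖⁻¹ • cross w a := by
        rw [← crossCLM_apply, map_smul, _root_.smul_apply, crossCLM_apply]
      rw [e, real_inner_smul_right, inner_cross_cyclic, ← hw]
    rw [h2, real_inner_self_eq_norm_sq] at h1
    have : ‖w‖⁻¹ * ‖w‖ ^ 2 = ‖w‖ := by field_simp
    rw [this] at h1
    exact hwn.ne' h1

/-! ### Σ-0c -/

/-- **Σ-0c `ClusterFluxZero`, proved**: a vanishing cluster flux on a cluster partition of a positive-radius sphere forces
`∇f × (x − x₀) = 0` on that sphere.  Statement = `CellFlux.ClusterFluxZero` (Defs twin p692073 = sketch verbatim). [folklore] -/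
theorem clusterFluxZero : ClusterFluxZero := by
  intro f x₀ r 𝒦 hr hf hpart hflux x hx
  by_cases hcrit : cross (gradient f x) (x - x₀) = 0
  · exact hcrit
  obtain ⟨hfin, hcls, hcover, -⟩ := hpart
  -- the sphere avoids the centre; `f` is continuous on it
  have hsph : Metric.sphere x₀ r ⊆ ({x₀}ᶜ : Set E3) := fun y hy h0 => by
    rw [mem_singleton_iff] at h0
    rw [h0, mem_sphere_iff_norm, sub_self, norm_zero] at hy
    exact hr.ne' hy.symm
  have hfc : ContinuousOn f (Metric.sphere x₀ r) := hf.continuousOn.mono hsph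
  have hKsub : ∀ K ∈ 𝒦, K ⊆ Metric.sphere x₀ r := fun K hK y hy => by
    have : y ∈ ⋃₀ 𝒦 := mem_sUnion.2 ⟨K, hK, hy⟩
    rw [hcover] at this
    exact this.1
  have hcpt : IsCompact (f '' Metric.sphere x₀ r) := (isCompact_sphere x₀ r).image_of_continuousOn hfc
  have hbA : ∀ K ∈ 𝒦, BddAbove (f '' K) := fun K hK => hcpt.bddAbove.mono (image_mono (hKsub K hK))
  have hbB : ∀ K ∈ 𝒦, BddBelow (f '' K) := fun K hK => hcpt.bddBelow.mono (image_mono (hKsub K hK))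
  -- every oscillation is `≥ 0`; they sum to `0`; hence each is `0` and `f` is constant on every class
  have hosc0 : ∀ K ∈ 𝒦, 0 ≤ setOsc f K := fun K hK => by
    obtain ⟨y, hy⟩ := (hcls K hK).1
    have h1 : f y ≤ sSup (f '' K) := le_csSup (hbA K hK) ⟨y, hy, rfl⟩
    have h2 : sInf (f '' K) ≤ f y := csInf_le (hbB K hK) ⟨y, hy, rfl⟩
    unfold setOsc; linarith
  have hsum : ∑ᶠ K ∈ 𝒦, setOsc f K = 0 := by
    have h := hflux
    unfold clusterFlux at h
    rcases mul_eq_zero.1 h with h | h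
    · exact absurd h hr.ne'
    · exact h
  have hzero : ∀ K ∈ 𝒦, setOsc f K = 0 := by
    rw [finsum_mem_eq_finite_toFinset_sum _ hfin] at hsum
    intro K hK
    exact (Finset.sum_eq_zero_iff_of_nonneg (fun K hK => hosc0 K (hfin.mem_toFinset.1 hK))).1 hsum K
      (hfin.mem_toFinset.2 hK)
  have hconst : ∀ K ∈ 𝒦, ∀ y ∈ K, ∀ z ∈ K, f y = f z := by
    intro K hK y hy z hz
    have h0 := hzero K hK
    unfold setOsc at h0
    have hy1 : f y ≤ sSup (f '' K) := le_csSup (hbA K hK) ⟨y, hy, rfl⟩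
    have hy2 : sInf (f '' K) ≤ f y := csInf_le (hbB K hK) ⟨y, hy, rfl⟩
    have hz1 : f z ≤ sSup (f '' K) := le_csSup (hbA K hK) ⟨z, hz, rfl⟩
    have hz2 : sInf (f '' K) ≤ f z := csInf_le (hbB K hK) ⟨z, hz, rfl⟩
    linarith
  -- `x` is not on a sheet trace, so it lies in a class `K`, indeed in a cell `C ⊆ K`
  have hxΓ : x ∉ sheetTrace f x₀ r := fun h => hcrit h.1.2
  have hxU : x ∈ ⋃₀ 𝒦 := by rw [hcover]; exact ⟨hx, hxΓ⟩
  obtain ⟨K, hK, hxK⟩ := mem_sUnion.1 hxU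
  obtain ⟨-, 𝒪, h𝒪, hKeq⟩ := hcls K hK
  have hxO : x ∈ ⋃₀ 𝒪 := by rw [← hKeq]; exact hxK
  obtain ⟨C, hC, hxC⟩ := mem_sUnion.1 hxO
  obtain ⟨y, -, hCy⟩ := h𝒪 hC
  have hCx : connectedComponentIn (Metric.sphere x₀ r \ sheetTrace f x₀ r) x = C := by
    rw [← hCy] at hxC ⊢
    exact (connectedComponentIn_eq hxC).symm
  have hCK : C ⊆ K := fun z hz => by rw [hKeq]; exact mem_sUnion.2 ⟨C, hC, hz⟩
  -- a neighbourhood of `x` free of sphere-critical points (continuity of `∇f`)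
  have hxne : x ≠ x₀ := hsph hx
  have hgc : ContinuousAt (fun z : E3 => cross (gradient f z) (z - x₀)) x := by
    have hU : IsOpen ({x₀}ᶜ : Set E3) := isOpen_compl_singleton
    have hD : ContinuousOn (fderiv ℝ f) ({x₀}ᶜ : Set E3) := hf.continuousOn_fderiv_of_isOpen hU le_rfl
    have hG : ContinuousOn (fun z => gradient f z) ({x₀}ᶜ : Set E3) :=
      ((InnerProductSpace.toDual ℝ E3).symm.continuous.comp_continuousOn hD).congr fun z _ => rfl
    have hGa : ContinuousAt (fun z => gradient f z) x := hG.continuousAt (hU.mem_nhds hxne)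
    have h2 : ContinuousAt (fun z : E3 => (gradient f z, z - x₀)) x := hGa.prodMk (continuousAt_id.sub continuousAt_const)
    have heq : (fun z : E3 => cross (gradient f z) (z - x₀)) = (fun p : E3 × E3 => crossCLM p.1 p.2) ∘ fun z => (gradient f z, z - x₀) := by
      funext z; simp only [Function.comp_apply, crossCLM_apply]
    rw [heq]
    exact ContinuousAt.comp (crossCLM.continuous₂.continuousAt) h2
  obtain ⟨ε, hε, hεV⟩ : ∃ ε > 0, ∀ z : E3, dist z x < ε → cross (gradient f z) (z - x₀) ≠ 0 := by
    have hev := hgc.eventually_ne hcrit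
    obtain ⟨ε, hε, h⟩ := Metric.eventually_nhds_iff.1 hev
    exact ⟨ε, hε, fun z hz => h hz⟩
  -- great circles through `x`: `f` is constant along short arcs, so `⟪∇f x, n × (x − x₀)⟫ = 0`
  have hdiffx : DifferentiableAt ℝ f x :=
    (hf.differentiableOn one_ne_zero x hxne).differentiableAt (isOpen_compl_singleton.mem_nhds hxne)
  have htan : ∀ n : E3, ‖n‖ = 1 → ⟪n, x - x₀⟫ = 0 → ⟪gradient f x, cross n (x - x₀)⟫ = 0 := by
    intro n hn hna
    set a : E3 := x - x₀ with ha
    set γ : ℝ → E3 := fun σ => x₀ + (1 : ℝ) • (Real.cos ((1 : ℝ) * σ) • a + Real.sin ((1 : ℝ) * σ) • cross n a) with hγ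
    have hγ0 : γ 0 = x := by simp [hγ, ha]
    have hγc : Continuous γ := by
      simp only [hγ]; fun_prop
    have hγsph : ∀ σ, γ σ ∈ Metric.sphere x₀ r := fun σ => by
      rw [mem_sphere_iff_norm, hγ]
      simp only [one_mul]
      rw [norm_greatCircle_sub_center hn hna x₀ σ zero_le_one, one_mul, ha, ← mem_sphere_iff_norm]
      exact hx
    -- short arcs stay in the critical-free neighbourhood, hence in `S ∖ Γ`
    obtain ⟨δ, hδ, hδε⟩ : ∃ δ > 0, ∀ σ : ℝ, |σ| ≤ δ → dist (γ σ) x < ε := by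
      have hct : ContinuousAt γ 0 := hγc.continuousAt
      obtain ⟨δ, hδ, h⟩ := Metric.continuousAt_iff.1 hct ε hε
      refine ⟨δ / 2, by positivity, fun σ hσ => ?_⟩
      have := h (x := σ) (by rw [dist_zero_right, Real.norm_eq_abs]; linarith)
      rwa [hγ0] at this
    have harc : γ '' Icc (-δ) δ ⊆ Metric.sphere x₀ r \ sheetTrace f x₀ r := by
      rintro _ ⟨σ, hσ, rfl⟩
      refine ⟨hγsph σ, fun hΓ => ?_⟩
      exact hεV (γ σ) (hδε σ (abs_le.2 ⟨by linarith [hσ.1], hσ.2⟩)) hΓ.1.2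
    have harcC : γ '' Icc (-δ) δ ⊆ C := by
      rw [← hCx]
      exact (isPreconnected_Icc.image γ hγc.continuousOn).subset_connectedComponentIn
        ⟨0, ⟨by linarith, hδ.le⟩, hγ0⟩ harc
    -- `f ∘ γ` is constant near `0`
    have hfγ : ∀ σ ∈ Icc (-δ) δ, f (γ σ) = f x := fun σ hσ =>
      hconst K hK _ (hCK (harcC ⟨σ, hσ, rfl⟩)) _ hxK
    have hev : (fun σ => f (γ σ)) =ᶠ[𝓝 0] fun _ => f x := by
      filter_upwards [Icc_mem_nhds (show -δ < 0 by linarith) hδ] with σ hσ using hfγ σ hσ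
    have hD0 : HasDerivAt (fun σ => f (γ σ)) 0 0 := (hasDerivAt_const (0 : ℝ) (f x)).congr_of_eventuallyEq hev
    -- chain rule
    have hγ' : HasDerivAt γ ((1 : ℝ) • ((1 : ℝ) • (-(Real.sin ((1 : ℝ) * 0)) • a + Real.cos ((1 : ℝ) * 0) • cross n a))) 0 :=
      hasDerivAt_greatCircle x₀ a n 1 1 0
    have hvel : (1 : ℝ) • ((1 : ℝ) • (-(Real.sin ((1 : ℝ) * 0)) • a + Real.cos ((1 : ℝ) * 0) • cross n a)) = cross n a := by
      simp
    rw [hvel] at hγ'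
    have hfx : HasFDerivAt f (fderiv ℝ f x) (γ 0) := by rw [hγ0]; exact hdiffx.hasFDerivAt
    have hD1 : HasDerivAt (fun σ => f (γ σ)) (fderiv ℝ f x (cross n a)) 0 := hfx.comp_hasDerivAt 0 hγ'
    have huniq : fderiv ℝ f x (cross n a) = 0 := hD1.unique hD0
    rw [gradient, InnerProductSpace.toDual_symm_apply]
    exact huniq
  exact cross_eq_zero_of_forall_inner_cross (gradient f x) (x - x₀) htan

end Summit.NavierStokesRegularity.NavierStokesRegularity.Theorems.PoloidalLiouville.CellFlux

end
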